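import Summits.BirchSwinnertonDyer.BirchSwinnertonDyer.Theorems.KimAtThreeStubPinnedOfSakamoto
import Summits.BirchSwinnertonDyer.BirchSwinnertonDyer.Theses.KimAtThreeKolyvagin
import HarnessLib

/-!
# Route `KimAtThreeKolyvagin` (rung W2), crux `StubAtEmptyLevelThree` (item 19561): the stub at `∅` for
# the PINNED datum at EVERY depth `k ≥ 0`, from the route's OWN sibling items `SakamotoKolyvaginThree`
# (stmt-19558) and `PoitouTateSelmerDuality` (stmt-19559) BY NAME + Tate's local Euler–Poincaré
# characteristic + three Poitou–Tate pair counts at `∅`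

Cell `bsd-addord`, seat `bsd-addord-w2-c5` (gen 3). TOOL FILE: theorems only, no definition, no named fact, no
`sorry`; closes nothing; books nothing. HONEST FRAMING: BSD is not proved by any of this; item 19561 stays
OPEN (aside): its signature as filed has NO antecedent, so no sorry-free file has its type (verdicts of w2-c5
gen 0 / gen 2 stand). What this file gives the planner is the EXACT re-signature that a kernel theorem
already closes: `stubAtEmptyLevelThree_pinned_of_parts` below.

* `stubShape_pinned_zero_of_sakamoto` — the depth `k = 0` slice (`E[3^0·3]`, `m = 1`): `n₀ = 0` is trivial and
  `n₀ ≥ 1` is [S24] Thm. 4.4 (2) clause 2 (`g ∅ = 0`); inputs: the pinned (2)-fact, the residual Poitou–Tate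
  family, `hEP`, the pair count at `∅` at level `0`.
* `stubShape_pinned_of_sakamoto_all` — every depth `k ≥ 0` (cases `k = 0` / `k = j + 1` =
  `stubShape_pinned_of_sakamoto`).
* ★ **`stubAtEmptyLevelThree_pinned_of_parts`** — `SakamotoKolyvaginThree → PoitouTateSelmerDuality →
  (∀ v, localEulerPoincareCharacteristic ℚ_v) → [pair counts at ∅ at the levels k, 2k, 2k+1, for every
  full-level Poitou–Tate family] → ∀ W (tower onto) η (generators) k τ (deep to 3^{2k+2}) S (finite ⊇ ∞,3,bad)
  Dk (THE PINNED canonical τ-datum of E[3^k·3]: primes = Sakamoto's class, cyclotomic transverse, canonical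
  comparison for η) g (ℕ-generator of KS₁) n₀ (#H¹_{𝓕_can} = 3^{k+1}·3^{n₀}), ∃ e m′, g ∅ = 3^{n₀}•e + m′` —
  item 19561's conclusion with item 19561's quantifier block RESTRICTED to pinned data with a deep `τ`, and
  the published / port-free antecedents DISPLAYED. The residual distance to the item as filed is recorded in
  the seat's memo (sub-data of the pinned class: w2-c5 gen 0/2 transfer, kernel at m = 1; the local
  cyclicity `H¹_s(ℚ₃, E[3^{i+1}])/im ≅ ℤ/3^{i+1}` behind the three pair counts = n1011's dictionary `Λ`).

References: [MazurRubin2004] Thm. 4.4.1, Thm. 4.4.3; [Sakamoto2024] Thm. 4.4 (1)(2) (p. 926); [MilneADT2006]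
I Thm. 2.8, Thm. 4.10; [Rubin2011] Thm. 2.8.4.
-/

set_option autoImplicit false
-- the Theorems namespace of a single-conjunct summit repeats the summit name by design (D-0017)
set_option linter.dupNamespace false

noncomputable section

open scoped Classical NumberField ContRepresentation
open Function Field NumberField IsDedekindDomain WeierstrassCurve Literature.NumberTheory.EllipticCurves
  Literature.NumberTheory.GaloisRepresentations Literature.NumberTheory.GaloisRepresentations.DiscreteGaloisModule
  Literature.NumberTheory.GaloisCohomology Literature.NumberTheory.GaloisCohomology.KolyvaginDatum
  Summit.BirchSwinnertonDyer.Rank1Residual.GaloisImage Summit.BirchSwinnertonDyer.Rank1Residual.GaloisImage.Transport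

namespace Summit.BirchSwinnertonDyer.BirchSwinnertonDyer.Theorems.KimAtThreeStubOfLiftable

open Summit.BirchSwinnertonDyer.BirchSwinnertonDyer.Theses.KimAtThreeKolyvagin

/-- **The depth `k = 0` slice** (`T = E[3^0·3]`, `R = ℤ/3`): for the pinned canonical `τ`-datum, an
ℕ-generator `g` of `KS₁` with `#H¹_{𝓕_can}(ℚ, E[3^0·3]) = 3·3^{n₀}` and the pair count at `∅`, `g ∅ = 3^{n₀}•e + m′`
(`n₀ = 0`: `e = g ∅`; `n₀ ≥ 1`: `g ∅ = 0` by [S24] Thm. 4.4 (2) clause 2). [cite: Sakamoto2024, Thm. 4.4 (2) (p. 926)]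
[cite: MazurRubin2004, Thm. 4.4.1 (p. 45)] -/
theorem stubShape_pinned_zero_of_sakamoto
    (hS24₂ : Sakamoto2024.kolyvaginSystems_idealOfBasis_eq_fittingIdeal_zmod_three_pow)
    (W : WeierstrassCurve ℚ) [W.IsElliptic] [Finite (geomTorsion W ((3 : ℕ) : ℤ))]
    (htower : ∀ n : ℕ, W.HasSurjectiveModNGaloisRep (3 ^ n : ℕ)) {n₀ : ℕ}
    [Finite (geomTorsion W (((3 : ℕ) : ℤ) ^ 0 * ((3 : ℕ) : ℤ)))]
    (τ : absoluteGaloisGroup ℚ) (hτμ : τ ∈ rootsOfUnityFixer ℚ (3 ^ (0 + 1)))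
    (hτq : Nonempty (cokerSubOne (W.torsionGaloisModule (((3 : ℕ) : ℤ) ^ 0 * ((3 : ℕ) : ℤ))) τ ≃+
      ZMod (3 ^ (0 + 1))))
    (inv₃ : LocalInvariants ℚ 3) (hperf₃ : inv₃.IsPerfect) (hsum₃ : inv₃.SumLocalTermEqZero)
    (hcompl₃ : inv₃.SelmerComplement)
    (hEP : ∀ v : HeightOneSpectrum (𝓞 ℚ), localEulerPoincareCharacteristic (v.adicCompletion ℚ))
    {S : Finset (Place ℚ)} (hS : ∀ w : InfinitePlace ℚ, (Sum.inl w : Place ℚ) ∈ S)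
    (h3S : ∀ v : HeightOneSpectrum (𝓞 ℚ), ((3 : ℕ) : 𝓞 ℚ) ∈ v.asIdeal → (Sum.inr v : Place ℚ) ∈ S)
    (hbadS : ∀ v : HeightOneSpectrum (𝓞 ℚ), ¬ W.HasGoodReductionAt v → (Sum.inr v : Place ℚ) ∈ S)
    {η : (q : HeightOneSpectrum (𝓞 ℚ)) → (ZMod (Ideal.absNorm q.asIdeal))ˣ}
    {Dk : KolyvaginDatum (W.torsionGaloisModule (((3 : ℕ) : ℤ) ^ 0 * ((3 : ℕ) : ℤ)))}
    (hPk : Dk.primes = frobeniusClassPrimes (W.torsionGaloisModule (((3 : ℕ) : ℤ) ^ 0 * ((3 : ℕ) : ℤ)))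
      {v | (Sum.inr v : Place ℚ) ∈ S} τ (3 ^ (0 + 1)))
    (hTk : Dk.transverse = cyclotomicTransverse _) (hDk : Dk.HasCanonicalComparison (3 ^ (0 + 1)) η)
    {g : Finset (HeightOneSpectrum (𝓞 ℚ)) →
      galoisCohomology (W.torsionGaloisModule (((3 : ℕ) : ℤ) ^ 0 * ((3 : ℕ) : ℤ))) 1}
    (hg : g ∈ Dk.kolyvaginSystems (propagatedSelmerStructure W 3 0))
    (hgen : ∀ κ ∈ Dk.kolyvaginSystems (propagatedSelmerStructure W 3 0), ∃ a : ℕ, κ = a • g)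
    (hcardk : Nat.card (propagatedSelmerStructure W 3 0).selmerGroup = 3 ^ (0 + 1 + n₀))
    (invk : LocalInvariants ℚ (3 ^ (0 + 1))) (hperfk : invk.IsPerfect) (hsumk : invk.SumLocalTermEqZero)
    (hcomplk : invk.SelmerComplement)
    (hPTk : Nat.card (propagatedSelmerStructure W 3 0).selmerGroup =
      3 ^ (0 + 1) * Nat.card (invk.dualSelmerStructure
        (W.torsionGaloisModule (((3 : ℕ) : ℤ) ^ 0 * ((3 : ℕ) : ℤ))) (propagatedSelmerStructure W 3 0)).selmerGroup) :
    ∃ e ∈ (propagatedSelmerStructure W 3 0).selmerGroup,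
      ∃ m' ∈ (W.kummerSelmerStructure (((3 : ℕ) : ℤ) ^ 0 * ((3 : ℕ) : ℤ))).selmerGroup,
        g ∅ = 3 ^ n₀ • e + m' := by
  haveI : Fact (Nat.Prime 3) := ⟨Nat.prime_three⟩
  haveI : NeZero (3 ^ (0 + 1)) := ⟨pow_ne_zero _ three_ne_zero⟩
  have hK : Dk.IsKolyvaginSystem (propagatedSelmerStructure W 3 0) g :=
    (KolyvaginDatum.mem_kolyvaginSystems_iff _ _ _).mp hg
  rcases Nat.eq_zero_or_pos n₀ with hn₀ | hn₀
  · exact ⟨g ∅, hK.apply_empty_mem, 0, zero_mem _, by rw [hn₀, add_zero]; exact (one_nsmul (g ∅)).symm⟩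
  -- `n₀ ≥ 1`: [S24] Thm. 4.4 (2) clause 2 gives `g ∅ = 0`
  have hunro₃ : inv₃.UnramifiedOrthogonal :=
    UnramifiedCup.unramifiedOrthogonal_of_isPerfect inv₃ Nat.prime_three.isPrimePow hperf₃
  let T : Finset (HeightOneSpectrum (𝓞 ℚ)) := S.preimage Sum.inr Sum.inr_injective.injOn
  have h3T : ∀ v : HeightOneSpectrum (𝓞 ℚ), ((3 : ℕ) : 𝓞 ℚ) ∈ v.asIdeal → v ∈ T :=
    fun v hv => Finset.mem_preimage.mpr (h3S v hv)
  have hbadT : ∀ v : HeightOneSpectrum (𝓞 ℚ), ¬ W.HasGoodReductionAt v → v ∈ T :=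
    fun v hv => Finset.mem_preimage.mpr (hbadS v hv)
  have hCR := hasCoreRank_one_propagatedSelmerStructureOne_of_isPerfect_of_localEuler W inv₃ hperf₃ hsum₃
    hcompl₃ hEP T h3T hbadT
  have hNk : Nat.card (invk.dualSelmerStructure
      (W.torsionGaloisModule (((3 : ℕ) : ℤ) ^ 0 * ((3 : ℕ) : ℤ))) (propagatedSelmerStructure W 3 0)).selmerGroup =
        3 ^ n₀ := by
    apply eq_pow_of_mul_eq_mul_pow (i := 0 + 1)
    rw [← hPTk, hcardk, pow_add]
  have hzg : AddSubgroup.zmultiples (⟨g, hg⟩ : Dk.kolyvaginSystems (propagatedSelmerStructure W 3 0)) = ⊤ :=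
    zmultiples_mk_eq_top_of_forall_eq_nsmul hg hgen
  have hR22k := kolyvaginSystems_idealOfBasis_propagatedSelmerStructure_of_towerSurj W hS24₂ 0 htower τ hτμ hτq
    inv₃ hperf₃ hsum₃ hunro₃ hcompl₃ S hS (fun v hv => not_mem_and_isUnramifiedAt_of_not_mem W 3 0 S h3S hbadS hv)
    (propagatedSelmerStructure_isUnramifiedOutside W 3 0 S hS h3S hbadS) (fun v _ => hEP v) hCR Dk η hPk hTk hDk
    invk hperfk hsumk
    (UnramifiedCup.unramifiedOrthogonal_of_isPerfect invk
      (Nat.prime_three.isPrimePow.pow (Nat.succ_ne_zero 0)) hperfk)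
    hcomplk ⟨g, hg⟩ hzg ∅ (KolyvaginDatum.isLevel_empty Dk)
  rw [atLevel_empty, hNk] at hR22k
  have h0 : g ∅ = 0 := hR22k.2 (pow_dvd_pow 3 (by omega))
  exact ⟨0, zero_mem _, 0, zero_mem _, by rw [h0, smul_zero, add_zero]⟩

/-- **Every depth `k ≥ 0`** (cases `k = 0`: `stubShape_pinned_zero_of_sakamoto`; `k = j + 1`:
`stubShape_pinned_of_sakamoto`). Binders: the two pinned [S24] facts, the tower, `τ` deep to `3^{2k+2}`, the
residual Poitou–Tate family, `hEP`, `S`, generators `η`, the PINNED canonical `τ`-datum at depth `k`, its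
ℕ-generator `g`, `#H¹_{𝓕_can} = 3^{k+1+n₀}`, and the pair counts at `∅` at the levels `k`, `2k`, `2k+1`.
[cite: MazurRubin2004, Thm. 4.4.3 (pp. 46–47)] [cite: Sakamoto2024, Thm. 4.4 (1)(2) (p. 926)] -/
theorem stubShape_pinned_of_sakamoto_all
    (hS24 : Sakamoto2024.kolyvaginSystems_freeRankOne_zmod_three_pow)
    (hS24₂ : Sakamoto2024.kolyvaginSystems_idealOfBasis_eq_fittingIdeal_zmod_three_pow)
    (W : WeierstrassCurve ℚ) [W.IsElliptic] [Finite (geomTorsion W ((3 : ℕ) : ℤ))]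
    (htower : ∀ n : ℕ, W.HasSurjectiveModNGaloisRep (3 ^ n : ℕ)) (k : ℕ) {n₀ : ℕ}
    [Finite (geomTorsion W (((3 : ℕ) : ℤ) ^ k * ((3 : ℕ) : ℤ)))]
    [Finite (geomTorsion W (((3 : ℕ) : ℤ) ^ (k + k) * ((3 : ℕ) : ℤ)))]
    [Finite (geomTorsion W (((3 : ℕ) : ℤ) ^ (k + k + 1) * ((3 : ℕ) : ℤ)))]
    (τ : absoluteGaloisGroup ℚ) (hτμ : τ ∈ rootsOfUnityFixer ℚ (3 ^ (k + k + 1 + 1)))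
    (hτq : Nonempty (cokerSubOne (W.torsionGaloisModule (((3 : ℕ) : ℤ) ^ (k + k + 1) * ((3 : ℕ) : ℤ))) τ ≃+
      ZMod (3 ^ (k + k + 1 + 1))))
    (inv₃ : LocalInvariants ℚ 3) (hperf₃ : inv₃.IsPerfect) (hsum₃ : inv₃.SumLocalTermEqZero)
    (hcompl₃ : inv₃.SelmerComplement)
    (hEP : ∀ v : HeightOneSpectrum (𝓞 ℚ), localEulerPoincareCharacteristic (v.adicCompletion ℚ))
    {S : Finset (Place ℚ)} (hS : ∀ w : InfinitePlace ℚ, (Sum.inl w : Place ℚ) ∈ S)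
    (h3S : ∀ v : HeightOneSpectrum (𝓞 ℚ), ((3 : ℕ) : 𝓞 ℚ) ∈ v.asIdeal → (Sum.inr v : Place ℚ) ∈ S)
    (hbadS : ∀ v : HeightOneSpectrum (𝓞 ℚ), ¬ W.HasGoodReductionAt v → (Sum.inr v : Place ℚ) ∈ S)
    {η : (q : HeightOneSpectrum (𝓞 ℚ)) → (ZMod (Ideal.absNorm q.asIdeal))ˣ}
    (hη : ∀ q, Subgroup.zpowers (η q) = ⊤)
    {Dk : KolyvaginDatum (W.torsionGaloisModule (((3 : ℕ) : ℤ) ^ k * ((3 : ℕ) : ℤ)))}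
    (hPk : Dk.primes = frobeniusClassPrimes (W.torsionGaloisModule (((3 : ℕ) : ℤ) ^ k * ((3 : ℕ) : ℤ)))
      {v | (Sum.inr v : Place ℚ) ∈ S} τ (3 ^ (k + 1)))
    (hTk : Dk.transverse = cyclotomicTransverse _) (hDk : Dk.HasCanonicalComparison (3 ^ (k + 1)) η)
    {g : Finset (HeightOneSpectrum (𝓞 ℚ)) →
      galoisCohomology (W.torsionGaloisModule (((3 : ℕ) : ℤ) ^ k * ((3 : ℕ) : ℤ))) 1}
    (hg : g ∈ Dk.kolyvaginSystems (propagatedSelmerStructure W 3 k))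
    (hgen : ∀ κ ∈ Dk.kolyvaginSystems (propagatedSelmerStructure W 3 k), ∃ a : ℕ, κ = a • g)
    (hcardk : Nat.card (propagatedSelmerStructure W 3 k).selmerGroup = 3 ^ (k + 1 + n₀))
    (invk : LocalInvariants ℚ (3 ^ (k + 1))) (hperfk : invk.IsPerfect) (hsumk : invk.SumLocalTermEqZero)
    (hcomplk : invk.SelmerComplement)
    (hPTk : Nat.card (propagatedSelmerStructure W 3 k).selmerGroup =
      3 ^ (k + 1) * Nat.card (invk.dualSelmerStructure
        (W.torsionGaloisModule (((3 : ℕ) : ℤ) ^ k * ((3 : ℕ) : ℤ))) (propagatedSelmerStructure W 3 k)).selmerGroup)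
    (invm : LocalInvariants ℚ (3 ^ (k + k + 1))) (hperfm : invm.IsPerfect) (hsumm : invm.SumLocalTermEqZero)
    (hcomplm : invm.SelmerComplement)
    (hPTm : Nat.card (propagatedSelmerStructure W 3 (k + k)).selmerGroup =
      3 ^ (k + k + 1) * Nat.card (invm.dualSelmerStructure
        (W.torsionGaloisModule (((3 : ℕ) : ℤ) ^ (k + k) * ((3 : ℕ) : ℤ)))
          (propagatedSelmerStructure W 3 (k + k))).selmerGroup)
    (invt : LocalInvariants ℚ (3 ^ (k + k + 1 + 1))) (hperft : invt.IsPerfect)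
    (hsumt : invt.SumLocalTermEqZero) (hcomplt : invt.SelmerComplement)
    (hPTt : Nat.card (propagatedSelmerStructure W 3 (k + k + 1)).selmerGroup =
      3 ^ (k + k + 1 + 1) * Nat.card (invt.dualSelmerStructure
        (W.torsionGaloisModule (((3 : ℕ) : ℤ) ^ (k + k + 1) * ((3 : ℕ) : ℤ)))
          (propagatedSelmerStructure W 3 (k + k + 1))).selmerGroup) :
    ∃ e ∈ (propagatedSelmerStructure W 3 k).selmerGroup,
      ∃ m' ∈ (W.kummerSelmerStructure (((3 : ℕ) : ℤ) ^ k * ((3 : ℕ) : ℤ))).selmerGroup,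
        g ∅ = 3 ^ n₀ • e + m' := by
  haveI : Fact (Nat.Prime 3) := ⟨Nat.prime_three⟩
  rcases k with _ | j
  · -- depth `0`: `τ` at level `3^{0+1}` from the deeper one
    have hτμ0 : τ ∈ rootsOfUnityFixer ℚ (3 ^ (0 + 1)) :=
      rootsOfUnityFixer_le_of_dvd ℚ (pow_dvd_pow 3 (by omega)) hτμ
    have hl' : ((3 : ℕ) : ℤ) ^ (0 + 0 + 1 + 1) = ((3 : ℕ) : ℤ) ^ (0 + 0 + 1) * ((3 : ℕ) : ℤ) := pow_succ _ _
    have h1 : Nonempty (cokerSubOne (W.torsionGaloisModule (((3 : ℕ) : ℤ) ^ (0 + 0 + 1 + 1))) τ ≃+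
        ZMod (3 ^ (0 + 0 + 1 + 1))) := by
      rw [hl']; exact hτq
    have hτq0 := nonempty_cokerSubOne_equiv_zmod_pow_of_le W Nat.prime_three
      (Nat.succ_le_succ (Nat.zero_le (0 + 0 + 1))) τ h1
    have hl : ((3 : ℕ) : ℤ) ^ (0 + 1) = ((3 : ℕ) : ℤ) ^ 0 * ((3 : ℕ) : ℤ) := pow_succ _ _
    rw [hl] at hτq0
    exact stubShape_pinned_zero_of_sakamoto hS24₂ W htower τ hτμ0 hτq0 inv₃ hperf₃ hsum₃ hcompl₃ hEP hS h3S
      hbadS hPk hTk hDk hg hgen hcardk invk hperfk hsumk hcomplk hPTk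
  · exact stubShape_pinned_of_sakamoto hS24 hS24₂ W htower (Nat.succ_pos j) τ hτμ hτq inv₃ hperf₃ hsum₃ hcompl₃
      hEP hS h3S hbadS hη hPk hTk hDk hg hgen hcardk invk hperfk hsumk hcomplk hPTk invm hperfm hsumm hcomplm
      hPTm invt hperft hsumt hcomplt hPTt

/-- ★ **Item 19561's conclusion for PINNED data from the route's sibling items BY NAME** — the exact
re-signature a kernel theorem closes. Antecedents: `SakamotoKolyvaginThree` (item 19558: [S24] Thm. 4.4 (1)
∧ (2) pinned, PUB), `PoitouTateSelmerDuality` (item 19559: Milne I 4.10, PUB), Tate's local Euler–Poincaré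
characteristic at the finite places of `ℚ` (Milne I 2.8, named fact), and the Poitou–Tate PAIR COUNTS AT `∅`
`#H¹_{𝓕_can}(ℚ, E[3^i·3]) = 3^{i+1} · #H¹_{𝓕_can^*}(ℚ, E[3^i·3]^∨(1))` at `i = k, 2k, 2k+1` for every
full-level Poitou–Tate family (n1011 `DeepLedger.natCard_selmerGroup_propagated_eq` given the local index
datum `Λ` at `3`). Conclusion: for every `E/ℚ` with the `3`-adic tower onto, generators `η`, depth `k`, `τ`
deep to `3^{2k+2}`, finite `S ⊇ ∞ ∪ {3} ∪ {bad}`, the PINNED canonical `τ`-datum `D_k` of `E[3^k·3]`, every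
ℕ-generator `g` of `KS₁(E[3^k·3], 𝓕_can, 𝒫)` and `n₀` with `#H¹_{𝓕_can} = 3^{k+1}·3^{n₀}`:
`g ∅ = 3^{n₀}•e + m′`, `e ∈ H¹_{𝓕_can}`, `m′ ∈ H¹_𝓚`. [cite: MazurRubin2004, Thm. 4.4.1 and Thm. 4.4.3 (pp. 45–47)]
[cite: Sakamoto2024, Thm. 4.4 (1)(2) (p. 926)] [cite: MilneADT2006, Ch. I, Thm. 2.8 and Thm. 4.10(b)] -/
theorem stubAtEmptyLevelThree_pinned_of_parts
    (hSak : SakamotoKolyvaginThree) (hPT : PoitouTateSelmerDuality)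
    (hEP : ∀ v : HeightOneSpectrum (𝓞 ℚ), localEulerPoincareCharacteristic (v.adicCompletion ℚ))
    -- the pair counts at `∅`, for every full-level Poitou–Tate family, at every depth
    (hPTcount : ∀ (W : WeierstrassCurve ℚ) [W.IsElliptic] (i : ℕ)
      [Finite (geomTorsion W (((3 : ℕ) : ℤ) ^ i * ((3 : ℕ) : ℤ)))] (inv : LocalInvariants ℚ (3 ^ (i + 1))),
      (∀ n : ℕ, W.HasSurjectiveModNGaloisRep (3 ^ n : ℕ)) →
      inv.IsPerfect → inv.SumLocalTermEqZero → inv.UnramifiedOrthogonal → inv.SelmerComplement →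
      Nat.card (propagatedSelmerStructure W 3 i).selmerGroup =
        3 ^ (i + 1) * Nat.card (inv.dualSelmerStructure
          (W.torsionGaloisModule (((3 : ℕ) : ℤ) ^ i * ((3 : ℕ) : ℤ))) (propagatedSelmerStructure W 3 i)).selmerGroup) :
    ∀ (W : WeierstrassCurve ℚ) [W.IsElliptic],
      (∀ n : ℕ, W.HasSurjectiveModNGaloisRep (3 ^ n : ℕ)) →
      ∀ (η : (q : HeightOneSpectrum (𝓞 ℚ)) → (ZMod (Ideal.absNorm q.asIdeal))ˣ),
        (∀ q, Subgroup.zpowers (η q) = ⊤) →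
      ∀ (k : ℕ) (τ : absoluteGaloisGroup ℚ), τ ∈ rootsOfUnityFixer ℚ (3 ^ (k + k + 1 + 1)) →
        Nonempty (cokerSubOne (W.torsionGaloisModule (((3 : ℕ) : ℤ) ^ (k + k + 1) * ((3 : ℕ) : ℤ))) τ ≃+
          ZMod (3 ^ (k + k + 1 + 1))) →
      ∀ (S : Finset (Place ℚ)), (∀ w : InfinitePlace ℚ, (Sum.inl w : Place ℚ) ∈ S) →
        (∀ v : HeightOneSpectrum (𝓞 ℚ), ((3 : ℕ) : 𝓞 ℚ) ∈ v.asIdeal → (Sum.inr v : Place ℚ) ∈ S) →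
        (∀ v : HeightOneSpectrum (𝓞 ℚ), ¬ W.HasGoodReductionAt v → (Sum.inr v : Place ℚ) ∈ S) →
      ∀ (Dk : KolyvaginDatum (W.torsionGaloisModule (((3 : ℕ) : ℤ) ^ k * ((3 : ℕ) : ℤ))))
        (g : Finset (HeightOneSpectrum (𝓞 ℚ)) →
          galoisCohomology (W.torsionGaloisModule (((3 : ℕ) : ℤ) ^ k * ((3 : ℕ) : ℤ))) 1) (n₀ : ℕ),
        Dk.primes = frobeniusClassPrimes (W.torsionGaloisModule (((3 : ℕ) : ℤ) ^ k * ((3 : ℕ) : ℤ)))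
          {v | (Sum.inr v : Place ℚ) ∈ S} τ (3 ^ (k + 1)) →
        Dk.transverse = cyclotomicTransverse _ → Dk.HasCanonicalComparison (3 ^ (k + 1)) η →
        g ∈ Dk.kolyvaginSystems (propagatedSelmerStructure W 3 k) →
        (∀ κ ∈ Dk.kolyvaginSystems (propagatedSelmerStructure W 3 k), ∃ a : ℕ, κ = a • g) →
        Nat.card (propagatedSelmerStructure W 3 k).selmerGroup = 3 ^ (k + 1) * 3 ^ n₀ →
        ∃ e ∈ (propagatedSelmerStructure W 3 k).selmerGroup,
          ∃ m ∈ (W.kummerSelmerStructure (((3 : ℕ) : ℤ) ^ k * ((3 : ℕ) : ℤ))).selmerGroup,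
            g ∅ = 3 ^ n₀ • e + m := by
  intro W _ htower η hη k τ hτμ hτq S hS h3S hbadS Dk g n₀ hPk hTk hDk hg hgen hcard
  haveI : Fact (Nat.Prime 3) := ⟨Nat.prime_three⟩
  haveI : ∀ i : ℕ, Finite (geomTorsion W (((3 : ℕ) : ℤ) ^ i * ((3 : ℕ) : ℤ))) := fun i =>
    finite_geomTorsion_pow_mul W 3 i
  haveI : Finite (geomTorsion W ((3 : ℕ) : ℤ)) := by
    have h := finite_geomTorsion_pow_mul W 3 0
    rwa [pow_zero, one_mul] at h
  haveI : NeZero (3 : ℕ) := ⟨three_ne_zero⟩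
  haveI : ∀ i : ℕ, NeZero (3 ^ (i + 1)) := fun i => ⟨pow_ne_zero _ three_ne_zero⟩
  obtain ⟨inv₃, hperf₃, hsum₃, -, hcompl₃⟩ := hPT 3
  obtain ⟨invk, hperfk, hsumk, hunrok, hcomplk⟩ := hPT (3 ^ (k + 1))
  obtain ⟨invm, hperfm, hsumm, hunrom, hcomplm⟩ := hPT (3 ^ (k + k + 1))
  obtain ⟨invt, hperft, hsumt, hunrot, hcomplt⟩ := hPT (3 ^ (k + k + 1 + 1))
  have hcardk : Nat.card (propagatedSelmerStructure W 3 k).selmerGroup = 3 ^ (k + 1 + n₀) := by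
    rw [hcard, ← pow_add]
  exact stubShape_pinned_of_sakamoto_all hSak.1 hSak.2 W htower k τ hτμ hτq inv₃ hperf₃ hsum₃ hcompl₃ hEP hS
    h3S hbadS hη hPk hTk hDk hg hgen hcardk invk hperfk hsumk hcomplk
    (hPTcount W k invk htower hperfk hsumk hunrok hcomplk) invm hperfm hsumm hcomplm
    (hPTcount W (k + k) invm htower hperfm hsumm hunrom hcomplm) invt hperft hsumt hcomplt
    (hPTcount W (k + k + 1) invt htower hperft hsumt hunrot hcomplt)

end Summit.BirchSwinnertonDyer.BirchSwinnertonDyer.Theorems.KimAtThreeStubOfLiftable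

end
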